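import Summits.BirchSwinnertonDyer.BirchSwinnertonDyer.Theorems.KatoDescentPotSupersingularWildUpperUnitTwistRecordsSharpPTam07
import Summits.BirchSwinnertonDyer.BirchSwinnertonDyer.Theorems.KatoDescentPotSupersingularWildUpperUnitTwistRecordsSharpPTam08
import Literature.NumberTheory.EllipticCurves.ModThreeImageCubeDiscriminantProofs
import HarnessLib

/-!
# Route `KatoDescentPotSupersingular` (rung K9, sub-rung B5 = O6 wild `p = 3`, cell `bsd-potss`): MOD-3 IMAGE KERNEL UPGRADE of the ♯ₚ
# unit-twist records on the CARTAN rows — «`ρ̄_(E,3)` NOT onto» IN THE KERNEL from `Δ(E)` being a CUBE, so that the displayed binder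
# `hns` (3-adic tower not onto) is DISCHARGED on top of the Tamagawa upgrade (part 06: 209088bs1@3, 237600t1@3, 237600v1@3, 338688bk1@3, 338688dh1@3, 338688e1@3)
# (seat `bsd-potss-k9-c4` g17; `--supports stmt-BirchSwinnertonDyer-19197 --as helper`)

HONEST FRAMING. THEOREMS ONLY (no definition, no named fact, no `sorry`); PER PAIR; nothing booked; items 19189 / 19197 / 21422 stay
OPEN class-wide; BSD is not proved for any class.  The ♯ₚ records display `hns : ¬ ∀ n, ρ̄_(E,3ⁿ) onto` — the row's mod-3 image
type (normaliser of a split / non-split Cartan) was so far a CENSUS DATUM (conjA-anchor g9 ROW-STATUS / kmc g21), not re-derived.  On a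
Cartan row the mod-3 image has order prime to 3, so `ℚ(∛Δ) ⊂ ℚ(E[3])` (Serre 1972 §5.3) forces `Δ(E) ∈ ℚ׳`; conversely the tree
THEOREM `ModThreeImage.not_hasSurjectiveModNGaloisRep_three_of_Δ_eq_cube` (`Literature/…/ModThreeImageCubeDiscriminantProofs`, PROVED,
no named fact) gives `Δ = s³ ⟹ ρ̄_(E,3)` not surjective, hence `hns`.  Per row below: `notSurjThree_g<label>` (`Δ(E₀) = s³` for the
literal integral model, `decide +kernel` + `norm_num`) and `missingUpperBoundAt_g<label>_3_img` = the Tamagawa-upgraded record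
`missingUpperBoundAt_g<label>_3_tam` (files `…RecordsSharpPTamNN`, this seat) with `hns` REMOVED as well.  After this upgrade a ♯ₚ record's
displayed row data are: the named facts + the schema, Cremona's `N`, `r_an = 0`, the lattice-optimal datum with `3 ∤ c(D)`, the field,
and the twist numerics — the image type and the Tamagawa data are kernel facts.  (The 9-deficient rows — `GL₂(𝔽₃)` onto mod 3, tower not
onto mod 9 — are NOT covered: `Δ` is not a cube there; their `hns` stays displayed.)

References: [Serre1972] §5.3; [SilvermanAEC2009] III.1, VII.1 Rem. 1.1; [Zywina2015ModL] §1 (images of ρ̄_(E,3)); [Jetchev2008] Cor. 1.5;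
[Miller2011LMS] Def. 1.1; [Cremona2006] Table 1.
-/

set_option autoImplicit false
set_option linter.dupNamespace false
noncomputable section
open scoped Classical NumberField
open WeierstrassCurve NumberField Field
  Literature.NumberTheory.EllipticCurves
  Literature.NumberTheory.EllipticCurves.ModularForms Literature.NumberTheory.EllipticCurves.Rank1Residual
  Literature.NumberTheory.EllipticCurves.Rank1Residual.Typed Literature.NumberTheory.Automorphic
  Literature.NumberTheory.EllipticCurves.Rank1Residual.X11RankOneCertificates
  Summit.BirchSwinnertonDyer.BirchSwinnertonDyer.Rank1Residual.IntModel
  Summit.BirchSwinnertonDyer.BirchSwinnertonDyer.Rank1Residual.X11RankOne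
  Summit.BirchSwinnertonDyer.Rank1Residual Summit.BirchSwinnertonDyer.Rank1Residual.Additive
  Summit.BirchSwinnertonDyer.BirchSwinnertonDyer.Theorems

namespace Summit.BirchSwinnertonDyer.BirchSwinnertonDyer.Theorems.WildUpperUnitTwistRecords

/-! ### `209088bs1`: `Δ = -2231656650432 = (-13068)³` — mod-3 image inside a Cartan normaliser, certified in the kernel -/

/-- **`ρ̄_(E,3)` is NOT surjective for `E = 209088bs1`** (kernel: `Δ(E) = (-13068)³` on the integral model `[0, 0, 0, -6534, 215622]`; Serre: `ℚ(E[3]) ⊇ ℚ(μ₃, ∛Δ)`, so a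
surjective image forces `Δ ∉ ℚ׳`; tree THEOREM `ModThreeImage.not_hasSurjectiveModNGaloisRep_three_of_Δ_eq_cube`). [cite: Serre1972, §5.3]
[cite: SilvermanAEC2009, III.1] [cite: Cremona2006, Table 1 (Cremona label 209088bs1)] -/
theorem notSurjThree_g209088bs1 {W : WeierstrassCurve ℚ} [W.IsElliptic] [W.IsGloballyMinimal]
    (hI : integralModelInt W = (⟨0, 0, 0, -6534, 215622⟩ : WeierstrassCurve ℤ)) : ¬ W.HasSurjectiveModNGaloisRep 3 := by
  have hD : discOf [0, 0, 0, (-6534), 215622] = (-2231656650432) := by decide +kernel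
  have hΔ : W.Δ = (((-2231656650432) : ℤ) : ℚ) := by rw [Δ_eq_cast hI, intCurve_Δ, hD]
  exact ModThreeImage.not_hasSurjectiveModNGaloisRep_three_of_Δ_eq_cube W (d := (((-13068) : ℤ) : ℚ)) (by rw [hΔ]; norm_num)

/-- **RECORD `209088bs1` @ `3` with the image binder `hns` AND the Tamagawa binders DISCHARGED** — `missingUpperBoundAt_g209088bs1_3_tam` (file
`…RecordsSharpPTam07`) with `hns` supplied by `notSurjThree_g209088bs1` (`n = 1`). Remaining displayed: named facts + schema, Cremona's `N`, `r_an = 0`,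
the lattice-optimal datum with `3 ∤ c(D)`, the field, the twist numerics. Per pair; nothing booked; BSD is not proved by this.
[cite: Serre1972, §5.3] [cite: Jetchev2008, Cor. 1.5] [cite: Miller2011LMS, Def. 1.1] [cite: Cremona2006, Table 1 (Cremona label 209088bs1)] -/
theorem missingUpperBoundAt_g209088bs1_3_img
    (hGZ : ∀ (N : ℕ) [NeZero N] (W : WeierstrassCurve ℚ) (K : Type) [Field K] [NumberField K],
      gross_zagier N W K)
    (hKo : ∀ (N : ℕ) [NeZero N] (W : WeierstrassCurve ℚ) (K : Type) [Field K] [NumberField K],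
      kolyvagin N W K)
    (hGZK : rank_eq_analyticRank_of_analyticRank_le_one) (hmod : hasEntireLFunction_rat)
    (hJp : ∀ (N : ℕ) [NeZero N] (W : WeierstrassCurve ℚ) [W.IsElliptic] [W.IsGloballyMinimal]
      (K : Type) [Field K] [NumberField K],
      IsImaginaryQuadratic K → NumberField.discr K ≠ -3 →
      SatisfiesHeegnerHypothesis N K → SatisfiesHeegnerHypothesis 2 K →
      ∀ (p : ℕ) [Fact p.Prime], p ≠ 2 → W.analyticRank = 0 → Addv W p → 0 ≤ padicValRat p W.j →
      ¬ W.HasCM → W.HasIrreducibleModPGaloisRep p →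
      ¬ (∀ n : ℕ, W.HasSurjectiveModNGaloisRep (p ^ n : ℕ)) →
      (∃ Dt : ModularParametrizationData W N,
        (∀ z ∈ Dt.L.lattice, ∃ w ∈ periodLattice Dt.f, z = (Dt.c : ℂ) * w) ∧ ¬ (p : ℤ) ∣ Dt.c) →
      ∀ {P : (W.baseChange K).toAffine.Point}, IsHeegnerPoint N W K P → ¬ IsOfFinAddOrder P → p ∣ N →
      padicValNat p (Nat.card (AddCommGroup.primaryComponent (W.baseChange K).sha p)) +
          2 * padicValNat p ((W.baseChange ℚ_[p]).localTamagawaNumber ℤ_[p]) ≤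
        2 * padicValNat p (AddSubgroup.zmultiples P).index)
    {W : WeierstrassCurve ℚ} [W.IsElliptic] [W.IsGloballyMinimal] (hWeq : W = (⟨0, 0, 0, (-6534), 215622⟩ : WeierstrassCurve ℚ))
    (hN : W.conductorNorm ℤ = 209088) (hr : W.analyticRank = 0)
    (D : ModularParametrizationData W 209088) (hopt : ∀ z ∈ D.L.lattice, ∃ w ∈ periodLattice D.f, z = (D.c : ℂ) * w)
    (hc : ¬ (3 : ℤ) ∣ D.c)
    (K : Type) [Field K] [NumberField K] (hK : IsImaginaryQuadratic K) (hdK : NumberField.discr K = -95)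
    {Wd : WeierstrassCurve ℚ} [Wd.IsElliptic] [Wd.IsGloballyMinimal] (hWdeq : Wd = (⟨0, 0, 0, (-58969350), (-184868912250)⟩ : WeierstrassCurve ℚ))
    (hrd : Wd.analyticRank = 1) {qd : ℚ} (hqd : shaAn Wd = (qd : ℂ)) (hvd : padicValRat 3 qd ≤ 0) :
    MissingUpperBoundAt W 3 := by
  have hI : integralModelInt W = (⟨0, 0, 0, -6534, 215622⟩ : WeierstrassCurve ℤ) := by
    subst hWeq; exact integralModelInt_eq_of_map_eq _ (map_mk_int 0 0 0 (-6534) 215622)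
  have hns : ¬ (∀ n : ℕ, W.HasSurjectiveModNGaloisRep (3 ^ n : ℕ)) := fun h =>
    notSurjThree_g209088bs1 hI (by simpa using h 1)
  exact missingUpperBoundAt_g209088bs1_3_tam hGZ hKo hGZK hmod hJp hWeq hN hr hns D hopt hc K hK hdK hWdeq hrd hqd hvd

/-! ### `237600t1`: `Δ = 209584584000000000 = (594000)³` — mod-3 image inside a Cartan normaliser, certified in the kernel -/

/-- **`ρ̄_(E,3)` is NOT surjective for `E = 237600t1`** (kernel: `Δ(E) = (594000)³` on the integral model `[0, 0, 0, -351000, -76950000]`; Serre: `ℚ(E[3]) ⊇ ℚ(μ₃, ∛Δ)`, so a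
surjective image forces `Δ ∉ ℚ׳`; tree THEOREM `ModThreeImage.not_hasSurjectiveModNGaloisRep_three_of_Δ_eq_cube`). [cite: Serre1972, §5.3]
[cite: SilvermanAEC2009, III.1] [cite: Cremona2006, Table 1 (Cremona label 237600t1)] -/
theorem notSurjThree_g237600t1 {W : WeierstrassCurve ℚ} [W.IsElliptic] [W.IsGloballyMinimal]
    (hI : integralModelInt W = (⟨0, 0, 0, -351000, -76950000⟩ : WeierstrassCurve ℤ)) : ¬ W.HasSurjectiveModNGaloisRep 3 := by
  have hD : discOf [0, 0, 0, (-351000), (-76950000)] = 209584584000000000 := by decide +kernel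
  have hΔ : W.Δ = ((209584584000000000 : ℤ) : ℚ) := by rw [Δ_eq_cast hI, intCurve_Δ, hD]
  exact ModThreeImage.not_hasSurjectiveModNGaloisRep_three_of_Δ_eq_cube W (d := ((594000 : ℤ) : ℚ)) (by rw [hΔ]; norm_num)

/-- **RECORD `237600t1` @ `3` with the image binder `hns` AND the Tamagawa binders DISCHARGED** — `missingUpperBoundAt_g237600t1_3_tam` (file
`…RecordsSharpPTam07`) with `hns` supplied by `notSurjThree_g237600t1` (`n = 1`). Remaining displayed: named facts + schema, Cremona's `N`, `r_an = 0`,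
the lattice-optimal datum with `3 ∤ c(D)`, the field, the twist numerics. Per pair; nothing booked; BSD is not proved by this.
[cite: Serre1972, §5.3] [cite: Jetchev2008, Cor. 1.5] [cite: Miller2011LMS, Def. 1.1] [cite: Cremona2006, Table 1 (Cremona label 237600t1)] -/
theorem missingUpperBoundAt_g237600t1_3_img
    (hGZ : ∀ (N : ℕ) [NeZero N] (W : WeierstrassCurve ℚ) (K : Type) [Field K] [NumberField K],
      gross_zagier N W K)
    (hKo : ∀ (N : ℕ) [NeZero N] (W : WeierstrassCurve ℚ) (K : Type) [Field K] [NumberField K],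
      kolyvagin N W K)
    (hGZK : rank_eq_analyticRank_of_analyticRank_le_one) (hmod : hasEntireLFunction_rat)
    (hJp : ∀ (N : ℕ) [NeZero N] (W : WeierstrassCurve ℚ) [W.IsElliptic] [W.IsGloballyMinimal]
      (K : Type) [Field K] [NumberField K],
      IsImaginaryQuadratic K → NumberField.discr K ≠ -3 →
      SatisfiesHeegnerHypothesis N K → SatisfiesHeegnerHypothesis 2 K →
      ∀ (p : ℕ) [Fact p.Prime], p ≠ 2 → W.analyticRank = 0 → Addv W p → 0 ≤ padicValRat p W.j →
      ¬ W.HasCM → W.HasIrreducibleModPGaloisRep p →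
      ¬ (∀ n : ℕ, W.HasSurjectiveModNGaloisRep (p ^ n : ℕ)) →
      (∃ Dt : ModularParametrizationData W N,
        (∀ z ∈ Dt.L.lattice, ∃ w ∈ periodLattice Dt.f, z = (Dt.c : ℂ) * w) ∧ ¬ (p : ℤ) ∣ Dt.c) →
      ∀ {P : (W.baseChange K).toAffine.Point}, IsHeegnerPoint N W K P → ¬ IsOfFinAddOrder P → p ∣ N →
      padicValNat p (Nat.card (AddCommGroup.primaryComponent (W.baseChange K).sha p)) +
          2 * padicValNat p ((W.baseChange ℚ_[p]).localTamagawaNumber ℤ_[p]) ≤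
        2 * padicValNat p (AddSubgroup.zmultiples P).index)
    {W : WeierstrassCurve ℚ} [W.IsElliptic] [W.IsGloballyMinimal] (hWeq : W = (⟨0, 0, 0, (-351000), (-76950000)⟩ : WeierstrassCurve ℚ))
    (hN : W.conductorNorm ℤ = 237600) (hr : W.analyticRank = 0)
    (D : ModularParametrizationData W 237600) (hopt : ∀ z ∈ D.L.lattice, ∃ w ∈ periodLattice D.f, z = (D.c : ℂ) * w)
    (hc : ¬ (3 : ℤ) ∣ D.c)
    (K : Type) [Field K] [NumberField K] (hK : IsImaginaryQuadratic K) (hdK : NumberField.discr K = -239)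
    {Wd : WeierstrassCurve ℚ} [Wd.IsElliptic] [Wd.IsGloballyMinimal] (hWdeq : Wd = (⟨0, 0, 0, (-20049471000), 1050515167050000⟩ : WeierstrassCurve ℚ))
    (hrd : Wd.analyticRank = 1) {qd : ℚ} (hqd : shaAn Wd = (qd : ℂ)) (hvd : padicValRat 3 qd ≤ 0) :
    MissingUpperBoundAt W 3 := by
  have hI : integralModelInt W = (⟨0, 0, 0, -351000, -76950000⟩ : WeierstrassCurve ℤ) := by
    subst hWeq; exact integralModelInt_eq_of_map_eq _ (map_mk_int 0 0 0 (-351000) (-76950000))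
  have hns : ¬ (∀ n : ℕ, W.HasSurjectiveModNGaloisRep (3 ^ n : ℕ)) := fun h =>
    notSurjThree_g237600t1 hI (by simpa using h 1)
  exact missingUpperBoundAt_g237600t1_3_tam hGZ hKo hGZK hmod hJp hWeq hN hr hns D hopt hc K hK hdK hWdeq hrd hqd hvd

/-! ### `237600v1`: `Δ = -1676676672000000 = (-118800)³` — mod-3 image inside a Cartan normaliser, certified in the kernel -/

/-- **`ρ̄_(E,3)` is NOT surjective for `E = 237600v1`** (kernel: `Δ(E) = (-118800)³` on the integral model `[0, 0, 0, -99900, -12312000]`; Serre: `ℚ(E[3]) ⊇ ℚ(μ₃, ∛Δ)`, so a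
surjective image forces `Δ ∉ ℚ׳`; tree THEOREM `ModThreeImage.not_hasSurjectiveModNGaloisRep_three_of_Δ_eq_cube`). [cite: Serre1972, §5.3]
[cite: SilvermanAEC2009, III.1] [cite: Cremona2006, Table 1 (Cremona label 237600v1)] -/
theorem notSurjThree_g237600v1 {W : WeierstrassCurve ℚ} [W.IsElliptic] [W.IsGloballyMinimal]
    (hI : integralModelInt W = (⟨0, 0, 0, -99900, -12312000⟩ : WeierstrassCurve ℤ)) : ¬ W.HasSurjectiveModNGaloisRep 3 := by
  have hD : discOf [0, 0, 0, (-99900), (-12312000)] = (-1676676672000000) := by decide +kernel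
  have hΔ : W.Δ = (((-1676676672000000) : ℤ) : ℚ) := by rw [Δ_eq_cast hI, intCurve_Δ, hD]
  exact ModThreeImage.not_hasSurjectiveModNGaloisRep_three_of_Δ_eq_cube W (d := (((-118800) : ℤ) : ℚ)) (by rw [hΔ]; norm_num)

/-- **RECORD `237600v1` @ `3` with the image binder `hns` AND the Tamagawa binders DISCHARGED** — `missingUpperBoundAt_g237600v1_3_tam` (file
`…RecordsSharpPTam07`) with `hns` supplied by `notSurjThree_g237600v1` (`n = 1`). Remaining displayed: named facts + schema, Cremona's `N`, `r_an = 0`,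
the lattice-optimal datum with `3 ∤ c(D)`, the field, the twist numerics. Per pair; nothing booked; BSD is not proved by this.
[cite: Serre1972, §5.3] [cite: Jetchev2008, Cor. 1.5] [cite: Miller2011LMS, Def. 1.1] [cite: Cremona2006, Table 1 (Cremona label 237600v1)] -/
theorem missingUpperBoundAt_g237600v1_3_img
    (hGZ : ∀ (N : ℕ) [NeZero N] (W : WeierstrassCurve ℚ) (K : Type) [Field K] [NumberField K],
      gross_zagier N W K)
    (hKo : ∀ (N : ℕ) [NeZero N] (W : WeierstrassCurve ℚ) (K : Type) [Field K] [NumberField K],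
      kolyvagin N W K)
    (hGZK : rank_eq_analyticRank_of_analyticRank_le_one) (hmod : hasEntireLFunction_rat)
    (hJp : ∀ (N : ℕ) [NeZero N] (W : WeierstrassCurve ℚ) [W.IsElliptic] [W.IsGloballyMinimal]
      (K : Type) [Field K] [NumberField K],
      IsImaginaryQuadratic K → NumberField.discr K ≠ -3 →
      SatisfiesHeegnerHypothesis N K → SatisfiesHeegnerHypothesis 2 K →
      ∀ (p : ℕ) [Fact p.Prime], p ≠ 2 → W.analyticRank = 0 → Addv W p → 0 ≤ padicValRat p W.j →
      ¬ W.HasCM → W.HasIrreducibleModPGaloisRep p →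
      ¬ (∀ n : ℕ, W.HasSurjectiveModNGaloisRep (p ^ n : ℕ)) →
      (∃ Dt : ModularParametrizationData W N,
        (∀ z ∈ Dt.L.lattice, ∃ w ∈ periodLattice Dt.f, z = (Dt.c : ℂ) * w) ∧ ¬ (p : ℤ) ∣ Dt.c) →
      ∀ {P : (W.baseChange K).toAffine.Point}, IsHeegnerPoint N W K P → ¬ IsOfFinAddOrder P → p ∣ N →
      padicValNat p (Nat.card (AddCommGroup.primaryComponent (W.baseChange K).sha p)) +
          2 * padicValNat p ((W.baseChange ℚ_[p]).localTamagawaNumber ℤ_[p]) ≤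
        2 * padicValNat p (AddSubgroup.zmultiples P).index)
    {W : WeierstrassCurve ℚ} [W.IsElliptic] [W.IsGloballyMinimal] (hWeq : W = (⟨0, 0, 0, (-99900), (-12312000)⟩ : WeierstrassCurve ℚ))
    (hN : W.conductorNorm ℤ = 237600) (hr : W.analyticRank = 0)
    (D : ModularParametrizationData W 237600) (hopt : ∀ z ∈ D.L.lattice, ∃ w ∈ periodLattice D.f, z = (D.c : ℂ) * w)
    (hc : ¬ (3 : ℤ) ∣ D.c)
    (K : Type) [Field K] [NumberField K] (hK : IsImaginaryQuadratic K) (hdK : NumberField.discr K = -359)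
    {Wd : WeierstrassCurve ℚ} [Wd.IsElliptic] [Wd.IsGloballyMinimal] (hWdeq : Wd = (⟨0, 0, 0, (-12875211900), 569655051048000⟩ : WeierstrassCurve ℚ))
    (hrd : Wd.analyticRank = 1) {qd : ℚ} (hqd : shaAn Wd = (qd : ℂ)) (hvd : padicValRat 3 qd ≤ 0) :
    MissingUpperBoundAt W 3 := by
  have hI : integralModelInt W = (⟨0, 0, 0, -99900, -12312000⟩ : WeierstrassCurve ℤ) := by
    subst hWeq; exact integralModelInt_eq_of_map_eq _ (map_mk_int 0 0 0 (-99900) (-12312000))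
  have hns : ¬ (∀ n : ℕ, W.HasSurjectiveModNGaloisRep (3 ^ n : ℕ)) := fun h =>
    notSurjThree_g237600v1 hI (by simpa using h 1)
  exact missingUpperBoundAt_g237600v1_3_tam hGZ hKo hGZK hmod hJp hWeq hN hr hns D hopt hc K hK hdK hWdeq hrd hqd hvd

/-! ### `338688bk1`: `Δ = -406671383849472 = (-74088)³` — mod-3 image inside a Cartan normaliser, certified in the kernel -/

/-- **`ρ̄_(E,3)` is NOT surjective for `E = 338688bk1`** (kernel: `Δ(E) = (-74088)³` on the integral model `[0, 0, 0, -92610, -10890936]`; Serre: `ℚ(E[3]) ⊇ ℚ(μ₃, ∛Δ)`, so a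
surjective image forces `Δ ∉ ℚ׳`; tree THEOREM `ModThreeImage.not_hasSurjectiveModNGaloisRep_three_of_Δ_eq_cube`). [cite: Serre1972, §5.3]
[cite: SilvermanAEC2009, III.1] [cite: Cremona2006, Table 1 (Cremona label 338688bk1)] -/
theorem notSurjThree_g338688bk1 {W : WeierstrassCurve ℚ} [W.IsElliptic] [W.IsGloballyMinimal]
    (hI : integralModelInt W = (⟨0, 0, 0, -92610, -10890936⟩ : WeierstrassCurve ℤ)) : ¬ W.HasSurjectiveModNGaloisRep 3 := by
  have hD : discOf [0, 0, 0, (-92610), (-10890936)] = (-406671383849472) := by decide +kernel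
  have hΔ : W.Δ = (((-406671383849472) : ℤ) : ℚ) := by rw [Δ_eq_cast hI, intCurve_Δ, hD]
  exact ModThreeImage.not_hasSurjectiveModNGaloisRep_three_of_Δ_eq_cube W (d := (((-74088) : ℤ) : ℚ)) (by rw [hΔ]; norm_num)

/-- **RECORD `338688bk1` @ `3` with the image binder `hns` AND the Tamagawa binders DISCHARGED** — `missingUpperBoundAt_g338688bk1_3_tam` (file
`…RecordsSharpPTam07`) with `hns` supplied by `notSurjThree_g338688bk1` (`n = 1`). Remaining displayed: named facts + schema, Cremona's `N`, `r_an = 0`,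
the lattice-optimal datum with `3 ∤ c(D)`, the field, the twist numerics. Per pair; nothing booked; BSD is not proved by this.
[cite: Serre1972, §5.3] [cite: Jetchev2008, Cor. 1.5] [cite: Miller2011LMS, Def. 1.1] [cite: Cremona2006, Table 1 (Cremona label 338688bk1)] -/
theorem missingUpperBoundAt_g338688bk1_3_img
    (hGZ : ∀ (N : ℕ) [NeZero N] (W : WeierstrassCurve ℚ) (K : Type) [Field K] [NumberField K],
      gross_zagier N W K)
    (hKo : ∀ (N : ℕ) [NeZero N] (W : WeierstrassCurve ℚ) (K : Type) [Field K] [NumberField K],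
      kolyvagin N W K)
    (hGZK : rank_eq_analyticRank_of_analyticRank_le_one) (hmod : hasEntireLFunction_rat)
    (hJp : ∀ (N : ℕ) [NeZero N] (W : WeierstrassCurve ℚ) [W.IsElliptic] [W.IsGloballyMinimal]
      (K : Type) [Field K] [NumberField K],
      IsImaginaryQuadratic K → NumberField.discr K ≠ -3 →
      SatisfiesHeegnerHypothesis N K → SatisfiesHeegnerHypothesis 2 K →
      ∀ (p : ℕ) [Fact p.Prime], p ≠ 2 → W.analyticRank = 0 → Addv W p → 0 ≤ padicValRat p W.j →
      ¬ W.HasCM → W.HasIrreducibleModPGaloisRep p →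
      ¬ (∀ n : ℕ, W.HasSurjectiveModNGaloisRep (p ^ n : ℕ)) →
      (∃ Dt : ModularParametrizationData W N,
        (∀ z ∈ Dt.L.lattice, ∃ w ∈ periodLattice Dt.f, z = (Dt.c : ℂ) * w) ∧ ¬ (p : ℤ) ∣ Dt.c) →
      ∀ {P : (W.baseChange K).toAffine.Point}, IsHeegnerPoint N W K P → ¬ IsOfFinAddOrder P → p ∣ N →
      padicValNat p (Nat.card (AddCommGroup.primaryComponent (W.baseChange K).sha p)) +
          2 * padicValNat p ((W.baseChange ℚ_[p]).localTamagawaNumber ℤ_[p]) ≤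
        2 * padicValNat p (AddSubgroup.zmultiples P).index)
    {W : WeierstrassCurve ℚ} [W.IsElliptic] [W.IsGloballyMinimal] (hWeq : W = (⟨0, 0, 0, (-92610), (-10890936)⟩ : WeierstrassCurve ℚ))
    (hN : W.conductorNorm ℤ = 338688) (hr : W.analyticRank = 0)
    (D : ModularParametrizationData W 338688) (hopt : ∀ z ∈ D.L.lattice, ∃ w ∈ periodLattice D.f, z = (D.c : ℂ) * w)
    (hc : ¬ (3 : ℤ) ∣ D.c)
    (K : Type) [Field K] [NumberField K] (hK : IsImaginaryQuadratic K) (hdK : NumberField.discr K = -47)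
    {Wd : WeierstrassCurve ℚ} [Wd.IsElliptic] [Wd.IsGloballyMinimal] (hWdeq : Wd = (⟨0, 0, 0, (-204575490), 1130729648328⟩ : WeierstrassCurve ℚ))
    (hrd : Wd.analyticRank = 1) {qd : ℚ} (hqd : shaAn Wd = (qd : ℂ)) (hvd : padicValRat 3 qd ≤ 0) :
    MissingUpperBoundAt W 3 := by
  have hI : integralModelInt W = (⟨0, 0, 0, -92610, -10890936⟩ : WeierstrassCurve ℤ) := by
    subst hWeq; exact integralModelInt_eq_of_map_eq _ (map_mk_int 0 0 0 (-92610) (-10890936))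
  have hns : ¬ (∀ n : ℕ, W.HasSurjectiveModNGaloisRep (3 ^ n : ℕ)) := fun h =>
    notSurjThree_g338688bk1 hI (by simpa using h 1)
  exact missingUpperBoundAt_g338688bk1_3_tam hGZ hKo hGZK hmod hJp hWeq hN hr hns D hopt hc K hK hdK hWdeq hrd hqd hvd

/-! ### `338688dh1`: `Δ = -1185630856704 = (-10584)³` — mod-3 image inside a Cartan normaliser, certified in the kernel -/

/-- **`ρ̄_(E,3)` is NOT surjective for `E = 338688dh1`** (kernel: `Δ(E) = (-10584)³` on the integral model `[0, 0, 0, -2646, 74088]`; Serre: `ℚ(E[3]) ⊇ ℚ(μ₃, ∛Δ)`, so a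
surjective image forces `Δ ∉ ℚ׳`; tree THEOREM `ModThreeImage.not_hasSurjectiveModNGaloisRep_three_of_Δ_eq_cube`). [cite: Serre1972, §5.3]
[cite: SilvermanAEC2009, III.1] [cite: Cremona2006, Table 1 (Cremona label 338688dh1)] -/
theorem notSurjThree_g338688dh1 {W : WeierstrassCurve ℚ} [W.IsElliptic] [W.IsGloballyMinimal]
    (hI : integralModelInt W = (⟨0, 0, 0, -2646, 74088⟩ : WeierstrassCurve ℤ)) : ¬ W.HasSurjectiveModNGaloisRep 3 := by
  have hD : discOf [0, 0, 0, (-2646), 74088] = (-1185630856704) := by decide +kernel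
  have hΔ : W.Δ = (((-1185630856704) : ℤ) : ℚ) := by rw [Δ_eq_cast hI, intCurve_Δ, hD]
  exact ModThreeImage.not_hasSurjectiveModNGaloisRep_three_of_Δ_eq_cube W (d := (((-10584) : ℤ) : ℚ)) (by rw [hΔ]; norm_num)

/-- **RECORD `338688dh1` @ `3` with the image binder `hns` AND the Tamagawa binders DISCHARGED** — `missingUpperBoundAt_g338688dh1_3_tam` (file
`…RecordsSharpPTam07`) with `hns` supplied by `notSurjThree_g338688dh1` (`n = 1`). Remaining displayed: named facts + schema, Cremona's `N`, `r_an = 0`,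
the lattice-optimal datum with `3 ∤ c(D)`, the field, the twist numerics. Per pair; nothing booked; BSD is not proved by this.
[cite: Serre1972, §5.3] [cite: Jetchev2008, Cor. 1.5] [cite: Miller2011LMS, Def. 1.1] [cite: Cremona2006, Table 1 (Cremona label 338688dh1)] -/
theorem missingUpperBoundAt_g338688dh1_3_img
    (hGZ : ∀ (N : ℕ) [NeZero N] (W : WeierstrassCurve ℚ) (K : Type) [Field K] [NumberField K],
      gross_zagier N W K)
    (hKo : ∀ (N : ℕ) [NeZero N] (W : WeierstrassCurve ℚ) (K : Type) [Field K] [NumberField K],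
      kolyvagin N W K)
    (hGZK : rank_eq_analyticRank_of_analyticRank_le_one) (hmod : hasEntireLFunction_rat)
    (hJp : ∀ (N : ℕ) [NeZero N] (W : WeierstrassCurve ℚ) [W.IsElliptic] [W.IsGloballyMinimal]
      (K : Type) [Field K] [NumberField K],
      IsImaginaryQuadratic K → NumberField.discr K ≠ -3 →
      SatisfiesHeegnerHypothesis N K → SatisfiesHeegnerHypothesis 2 K →
      ∀ (p : ℕ) [Fact p.Prime], p ≠ 2 → W.analyticRank = 0 → Addv W p → 0 ≤ padicValRat p W.j →
      ¬ W.HasCM → W.HasIrreducibleModPGaloisRep p →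
      ¬ (∀ n : ℕ, W.HasSurjectiveModNGaloisRep (p ^ n : ℕ)) →
      (∃ Dt : ModularParametrizationData W N,
        (∀ z ∈ Dt.L.lattice, ∃ w ∈ periodLattice Dt.f, z = (Dt.c : ℂ) * w) ∧ ¬ (p : ℤ) ∣ Dt.c) →
      ∀ {P : (W.baseChange K).toAffine.Point}, IsHeegnerPoint N W K P → ¬ IsOfFinAddOrder P → p ∣ N →
      padicValNat p (Nat.card (AddCommGroup.primaryComponent (W.baseChange K).sha p)) +
          2 * padicValNat p ((W.baseChange ℚ_[p]).localTamagawaNumber ℤ_[p]) ≤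
        2 * padicValNat p (AddSubgroup.zmultiples P).index)
    {W : WeierstrassCurve ℚ} [W.IsElliptic] [W.IsGloballyMinimal] (hWeq : W = (⟨0, 0, 0, (-2646), 74088⟩ : WeierstrassCurve ℚ))
    (hN : W.conductorNorm ℤ = 338688) (hr : W.analyticRank = 0)
    (D : ModularParametrizationData W 338688) (hopt : ∀ z ∈ D.L.lattice, ∃ w ∈ periodLattice D.f, z = (D.c : ℂ) * w)
    (hc : ¬ (3 : ℤ) ∣ D.c)
    (K : Type) [Field K] [NumberField K] (hK : IsImaginaryQuadratic K) (hdK : NumberField.discr K = -47)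
    {Wd : WeierstrassCurve ℚ} [Wd.IsElliptic] [Wd.IsGloballyMinimal] (hWdeq : Wd = (⟨0, 0, 0, (-5845014), (-7692038424)⟩ : WeierstrassCurve ℚ))
    (hrd : Wd.analyticRank = 1) {qd : ℚ} (hqd : shaAn Wd = (qd : ℂ)) (hvd : padicValRat 3 qd ≤ 0) :
    MissingUpperBoundAt W 3 := by
  have hI : integralModelInt W = (⟨0, 0, 0, -2646, 74088⟩ : WeierstrassCurve ℤ) := by
    subst hWeq; exact integralModelInt_eq_of_map_eq _ (map_mk_int 0 0 0 (-2646) 74088)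
  have hns : ¬ (∀ n : ℕ, W.HasSurjectiveModNGaloisRep (3 ^ n : ℕ)) := fun h =>
    notSurjThree_g338688dh1 hI (by simpa using h 1)
  exact missingUpperBoundAt_g338688dh1_3_tam hGZ hKo hGZK hmod hJp hWeq hN hr hns D hopt hc K hK hdK hWdeq hrd hqd hvd

/-! ### `338688e1`: `Δ = -75880374829056 = (-42336)³` — mod-3 image inside a Cartan normaliser, certified in the kernel -/

/-- **`ρ̄_(E,3)` is NOT surjective for `E = 338688e1`** (kernel: `Δ(E) = (-42336)³` on the integral model `[0, 0, 0, -10584, -592704]`; Serre: `ℚ(E[3]) ⊇ ℚ(μ₃, ∛Δ)`, so a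
surjective image forces `Δ ∉ ℚ׳`; tree THEOREM `ModThreeImage.not_hasSurjectiveModNGaloisRep_three_of_Δ_eq_cube`). [cite: Serre1972, §5.3]
[cite: SilvermanAEC2009, III.1] [cite: Cremona2006, Table 1 (Cremona label 338688e1)] -/
theorem notSurjThree_g338688e1 {W : WeierstrassCurve ℚ} [W.IsElliptic] [W.IsGloballyMinimal]
    (hI : integralModelInt W = (⟨0, 0, 0, -10584, -592704⟩ : WeierstrassCurve ℤ)) : ¬ W.HasSurjectiveModNGaloisRep 3 := by
  have hD : discOf [0, 0, 0, (-10584), (-592704)] = (-75880374829056) := by decide +kernel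
  have hΔ : W.Δ = (((-75880374829056) : ℤ) : ℚ) := by rw [Δ_eq_cast hI, intCurve_Δ, hD]
  exact ModThreeImage.not_hasSurjectiveModNGaloisRep_three_of_Δ_eq_cube W (d := (((-42336) : ℤ) : ℚ)) (by rw [hΔ]; norm_num)

/-- **RECORD `338688e1` @ `3` with the image binder `hns` AND the Tamagawa binders DISCHARGED** — `missingUpperBoundAt_g338688e1_3_tam` (file
`…RecordsSharpPTam08`) with `hns` supplied by `notSurjThree_g338688e1` (`n = 1`). Remaining displayed: named facts + schema, Cremona's `N`, `r_an = 0`,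
the lattice-optimal datum with `3 ∤ c(D)`, the field, the twist numerics. Per pair; nothing booked; BSD is not proved by this.
[cite: Serre1972, §5.3] [cite: Jetchev2008, Cor. 1.5] [cite: Miller2011LMS, Def. 1.1] [cite: Cremona2006, Table 1 (Cremona label 338688e1)] -/
theorem missingUpperBoundAt_g338688e1_3_img
    (hGZ : ∀ (N : ℕ) [NeZero N] (W : WeierstrassCurve ℚ) (K : Type) [Field K] [NumberField K],
      gross_zagier N W K)
    (hKo : ∀ (N : ℕ) [NeZero N] (W : WeierstrassCurve ℚ) (K : Type) [Field K] [NumberField K],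
      kolyvagin N W K)
    (hGZK : rank_eq_analyticRank_of_analyticRank_le_one) (hmod : hasEntireLFunction_rat)
    (hJp : ∀ (N : ℕ) [NeZero N] (W : WeierstrassCurve ℚ) [W.IsElliptic] [W.IsGloballyMinimal]
      (K : Type) [Field K] [NumberField K],
      IsImaginaryQuadratic K → NumberField.discr K ≠ -3 →
      SatisfiesHeegnerHypothesis N K → SatisfiesHeegnerHypothesis 2 K →
      ∀ (p : ℕ) [Fact p.Prime], p ≠ 2 → W.analyticRank = 0 → Addv W p → 0 ≤ padicValRat p W.j →
      ¬ W.HasCM → W.HasIrreducibleModPGaloisRep p →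
      ¬ (∀ n : ℕ, W.HasSurjectiveModNGaloisRep (p ^ n : ℕ)) →
      (∃ Dt : ModularParametrizationData W N,
        (∀ z ∈ Dt.L.lattice, ∃ w ∈ periodLattice Dt.f, z = (Dt.c : ℂ) * w) ∧ ¬ (p : ℤ) ∣ Dt.c) →
      ∀ {P : (W.baseChange K).toAffine.Point}, IsHeegnerPoint N W K P → ¬ IsOfFinAddOrder P → p ∣ N →
      padicValNat p (Nat.card (AddCommGroup.primaryComponent (W.baseChange K).sha p)) +
          2 * padicValNat p ((W.baseChange ℚ_[p]).localTamagawaNumber ℤ_[p]) ≤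
        2 * padicValNat p (AddSubgroup.zmultiples P).index)
    {W : WeierstrassCurve ℚ} [W.IsElliptic] [W.IsGloballyMinimal] (hWeq : W = (⟨0, 0, 0, (-10584), (-592704)⟩ : WeierstrassCurve ℚ))
    (hN : W.conductorNorm ℤ = 338688) (hr : W.analyticRank = 0)
    (D : ModularParametrizationData W 338688) (hopt : ∀ z ∈ D.L.lattice, ∃ w ∈ periodLattice D.f, z = (D.c : ℂ) * w)
    (hc : ¬ (3 : ℤ) ∣ D.c)
    (K : Type) [Field K] [NumberField K] (hK : IsImaginaryQuadratic K) (hdK : NumberField.discr K = -47)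
    {Wd : WeierstrassCurve ℚ} [Wd.IsElliptic] [Wd.IsGloballyMinimal] (hWdeq : Wd = (⟨0, 0, 0, (-23380056), 61536307392⟩ : WeierstrassCurve ℚ))
    (hrd : Wd.analyticRank = 1) {qd : ℚ} (hqd : shaAn Wd = (qd : ℂ)) (hvd : padicValRat 3 qd ≤ 0) :
    MissingUpperBoundAt W 3 := by
  have hI : integralModelInt W = (⟨0, 0, 0, -10584, -592704⟩ : WeierstrassCurve ℤ) := by
    subst hWeq; exact integralModelInt_eq_of_map_eq _ (map_mk_int 0 0 0 (-10584) (-592704))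
  have hns : ¬ (∀ n : ℕ, W.HasSurjectiveModNGaloisRep (3 ^ n : ℕ)) := fun h =>
    notSurjThree_g338688e1 hI (by simpa using h 1)
  exact missingUpperBoundAt_g338688e1_3_tam hGZ hKo hGZK hmod hJp hWeq hN hr hns D hopt hc K hK hdK hWdeq hrd hqd hvd

end Summit.BirchSwinnertonDyer.BirchSwinnertonDyer.Theorems.WildUpperUnitTwistRecords

end
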